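import Mathlib
import HarnessLib
import Summits.Parity.GeneralizedHardyLittlewood.Theses.InverseSieveTuples

/-!
# Refutation of `InverseSieveTuples.TupleElliott` (stmt-Parity-14832)

`TupleElliott` fixes the exemption level `A₀ = A₀(t, L, η)` BEFORE the scale `N`, while
`affLinSize Ψ N ≤ L` admits shifts `|b_i| ≤ (L - 2) N`. Shift-divisor blindness: with `t = 1`,
`L = 3`, `η = 1/1000`, given `A₀, N₀` choose `z` with `∑_{p ≤ z} 1/p ≥ A₀`, the shift `P = z!`, the
system `Ψ = (n, n + P)`, the interval `[1, N]` and the multiplicative `1`-bounded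
`f = 1_{(n, P) = 1}` (indicator of the integers coprime to `P`, i.e. of the `z`-rough numbers).
Since `f(p) = 0` for `p ≤ z`, `𝔻(f, g; N)² ≥ ∑_{p ≤ z} 1/p ≥ A₀` for EVERY `1`-bounded `g` (all twisted
characters included), but `(n + P, P) = (n, P)`, so
`∑_{n ≤ N} Λ(n) f(n + P) = ∑_{n ≤ N, (n,P)=1} Λ(n) ≥ θ(N) - θ(z) ≥ 0.29 N` (Chebyshev), against the
claimed `η (N + ψ(N)) < 0.0064 N`. Classification `refuted-misstated`: primes dividing the shift
(generally `D(Ψ) = a_t ∏_{i<t} (a_i b_t − a_t b_i)`) never divide `ψ_t(n)` on the sifted support, so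
the part of `𝔻²` they carry is invisible. Repairs the witness misses: (C′) `affLinSize Ψ 1 ≤ L`
(bounded shifts); (C″) keep `|b| ≤ LN` but sum the distance only over `p ∤ D(Ψ)`; (C‴) a threshold
`w(N)` with `w(N) - log log log N → ∞` in place of the constant `A₀`. [folklore]
-/

namespace Summit.Parity.GeneralizedHardyLittlewood.Theorems

open Literature.NumberTheory.Sieve Filter
open scoped ArithmeticFunction.vonMangoldt ComplexConjugate

/-- Refutes `InverseSieveTuples.TupleElliott` [refuted-misstated]: at `t = 1`, `L = 3`,
`η = 1/1000`, for every `A₀, N₀` the system `(n, n + z!)` with `∑_{p ≤ z} 1/p ≥ A₀`, the interval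
`[1, N]` and `f = 1_{(·, z!) = 1}` satisfy every hypothesis (`𝔻² ≥ ∑_{p≤z} 1/p ≥ A₀` against all
twisted characters) while `∑_{n ≤ N} Λ(n) f(n + z!) = ∑_{n ≤ N, (n, z!) = 1} Λ(n) ≥ θ(N) − θ(z) ≥ 0.29 N`
exceeds `η (N + ψ(N)) ≤ 0.0064 N`; witness: `N ≥ max(N₀, z!, 14 z)` past two `o(N)` thresholds.
Repaired statement (C′, bounded shifts): replace `affLinSize Ψ N ≤ L` by `affLinSize Ψ 1 ≤ L`;
or (C″) keep `|b| ≤ LN` and sum the pretentious distance only over primes `p ∤ D(Ψ)`,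
`D(Ψ) = a_t ∏_{i<t} (a_i b_t − a_t b_i)`; the witness misses both. [folklore] -/
theorem InverseSieveTuplesTupleElliott_refuted :
    ¬ Summit.Parity.GeneralizedHardyLittlewood.Theses.InverseSieveTuples.TupleElliott := by
  intro h
  obtain ⟨A₀, N₀, hP⟩ := h 1 3 le_rfl (1 / 1000) (by norm_num)
  -- (1) `z` with `∑_{p ≤ z} 1/p ≥ A₀`
  obtain ⟨z, hz2, hzA⟩ : ∃ z : ℕ, 2 ≤ z ∧ A₀ ≤ ∑ p ∈ Nat.primesLE z, (1 : ℝ) / p := by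
    have hs := not_summable_one_div_on_primes
    rw [not_summable_iff_tendsto_nat_atTop_of_nonneg
        (fun n => Set.indicator_nonneg (fun m _ => by positivity) n)] at hs
    obtain ⟨n, hn⟩ := (hs.eventually_ge_atTop A₀).exists
    refine ⟨n + 2, by omega, hn.trans ?_⟩
    have hre : ∑ i ∈ Finset.range n, Set.indicator {p : ℕ | p.Prime} (fun m : ℕ => (1 : ℝ) / m) i
        = ∑ p ∈ (Finset.range n).filter Nat.Prime, (1 : ℝ) / p := by
      rw [Finset.sum_filter]
      refine Finset.sum_congr rfl fun i _ => ?_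
      by_cases hi : i.Prime
      · rw [Set.indicator_of_mem (show i ∈ {p : ℕ | p.Prime} from hi), if_pos hi]
      · rw [Set.indicator_of_notMem (show i ∉ {p : ℕ | p.Prime} from hi), if_neg hi]
    rw [hre]
    refine Finset.sum_le_sum_of_subset_of_nonneg (fun p hp => ?_) fun _ _ _ => by positivity
    rw [Finset.mem_filter, Finset.mem_range] at hp
    exact Nat.mem_primesLE.2 ⟨by omega, hp.2⟩
  -- (2) the shift `P = z!`
  obtain ⟨P, hPdef⟩ : ∃ P : ℕ, P = z.factorial := ⟨_, rfl⟩
  have hzP : z ≤ P := hPdef ▸ Nat.self_le_factorial z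
  have hP1 : P ≠ 1 := by omega
  have hP0 : (P : ℤ) ≠ 0 := by exact_mod_cast (show P ≠ 0 by omega)
  have hpP : ∀ p, p.Prime → (p ∣ P ↔ p ≤ z) := fun p hp => by rw [hPdef]; exact hp.dvd_factorial
  -- (3) the test function `f = 1_{(·, P) = 1}`
  obtain ⟨f, hf⟩ : ∃ f : ArithmeticFunction ℂ, ∀ n, f n = if Nat.Coprime n P then 1 else 0 :=
    ⟨⟨fun n => if Nat.Coprime n P then 1 else 0,
      if_neg (by rw [Nat.coprime_zero_left]; exact hP1)⟩, fun _ => rfl⟩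
  have hfmul : f.IsMultiplicative := by
    refine ⟨by rw [hf, if_pos (Nat.coprime_one_left P)], fun {m n} _ => ?_⟩
    rw [hf, hf, hf]
    by_cases hm : Nat.Coprime m P <;> by_cases hn : Nat.Coprime n P
    · rw [if_pos (Nat.coprime_mul_iff_left.2 ⟨hm, hn⟩), if_pos hm, if_pos hn, one_mul]
    · rw [if_neg (fun h => hn (Nat.coprime_mul_iff_left.1 h).2), if_pos hm, if_neg hn, mul_zero]
    · rw [if_neg (fun h => hm (Nat.coprime_mul_iff_left.1 h).1), if_neg hm, if_pos hn, zero_mul]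
    · rw [if_neg (fun h => hm (Nat.coprime_mul_iff_left.1 h).1), if_neg hm, if_neg hn, zero_mul]
  have hfle : ∀ n, ‖f n‖ ≤ 1 := fun n => by
    rw [hf]
    split_ifs <;> simp
  have hfp : ∀ p, p.Prime → p ≤ z → f p = 0 := fun p hp hpz => by
    rw [hf, if_neg (fun hc => (hp.coprime_iff_not_dvd.1 hc) ((hpP p hp).2 hpz))]
  -- (4) `f` is non-pretentious at level `A₀` against every `1`-bounded `g`, at every height `≥ z`
  have hdist : ∀ g : ℕ → ℂ, (∀ p, p.Prime → ‖g p‖ ≤ 1) → ∀ x : ℝ, (z : ℝ) ≤ x →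
      A₀ ≤ pretentiousDistSq f g x := by
    intro g hg x hx
    refine hzA.trans ?_
    unfold pretentiousDistSq
    have hsub : Nat.primesLE z ⊆ Nat.primesLE ⌊x⌋₊ := fun p hp => by
      rw [Nat.mem_primesLE] at hp ⊢
      exact ⟨hp.1.trans (Nat.le_floor hx), hp.2⟩
    have hnn : ∀ p ∈ Nat.primesLE ⌊x⌋₊, p ∉ Nat.primesLE z →
        0 ≤ (1 - (f p * conj (g p)).re) / (p : ℝ) := by
      intro p hp _
      refine div_nonneg (sub_nonneg.2 ?_) (Nat.cast_nonneg p)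
      calc (f p * conj (g p)).re ≤ ‖f p * conj (g p)‖ := Complex.re_le_norm _
        _ = ‖f p‖ * ‖g p‖ := by rw [norm_mul, Complex.norm_conj]
        _ ≤ 1 * 1 :=
          mul_le_mul (hfle p) (hg p (Nat.prime_of_mem_primesLE hp)) (norm_nonneg _) zero_le_one
        _ = 1 := one_mul 1
    calc ∑ p ∈ Nat.primesLE z, (1 : ℝ) / p
        = ∑ p ∈ Nat.primesLE z, (1 - (f p * conj (g p)).re) / (p : ℝ) := by
          refine Finset.sum_congr rfl fun p hp => ?_
          rw [Nat.mem_primesLE] at hp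
          rw [hfp p hp.2 hp.1]
          simp
      _ ≤ _ := Finset.sum_le_sum_of_subset_of_nonneg hsub hnn
  have htw : ∀ {q : ℕ} (χ : DirichletCharacter ℂ q) (τ : ℝ) (p : ℕ), p.Prime →
      ‖twistedChar χ τ p‖ ≤ 1 := by
    intro q χ τ p hp
    unfold twistedChar
    rw [norm_mul]
    refine mul_le_one₀ (χ.norm_le_one p) (norm_nonneg _) ?_
    rw [Complex.norm_natCast_cpow_of_pos hp.pos]
    simp
  -- (5) the system `Ψ = (n, n + P)`
  obtain ⟨Ψ, hΨl, hΨc⟩ : ∃ Ψ : Fin (1 + 1) → AffLinForm 1,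
      Ψ (Fin.last 1) = ⟨fun _ => 1, (P : ℤ)⟩ ∧ ∀ i : Fin 1, Ψ (Fin.castSucc i) = ⟨fun _ => 1, 0⟩ :=
    ⟨Fin.snoc (fun _ : Fin 1 => (⟨fun _ => 1, 0⟩ : AffLinForm 1)) ⟨fun _ => 1, (P : ℤ)⟩,
      Fin.snoc_last _ _, fun i => Fin.snoc_castSucc (α := fun _ => AffLinForm 1) _ _ _⟩
  have hev1 : ∀ n : Fin 1 → ℤ, (⟨fun _ => 1, (P : ℤ)⟩ : AffLinForm 1).eval n = n 0 + P :=
    fun n => by simp [AffLinForm.eval]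
  have hev0 : ∀ n : Fin 1 → ℤ, (⟨fun _ => 1, 0⟩ : AffLinForm 1).eval n = n 0 :=
    fun n => by simp [AffLinForm.eval]
  have hnd : IsNondegenerateSystem Ψ := by
    constructor
    · intro i hi
      have h1 : (Ψ i).coeff 0 = 1 := by
        rcases Fin.eq_castSucc_or_eq_last i with ⟨j, rfl⟩ | rfl
        · simp only [hΨc]
        · simp only [hΨl]
      rw [hi] at h1
      exact absurd h1 (by simp)
    · intro i j hij a b hab
      rcases Fin.eq_castSucc_or_eq_last i with ⟨i, rfl⟩ | rfl <;>
        rcases Fin.eq_castSucc_or_eq_last j with ⟨j, rfl⟩ | rfl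
      · exact absurd (by rw [Subsingleton.elim i j]) hij
      · have h0 := hab (fun _ => 0)
        have h1 := hab (fun _ => 1)
        simp only [hΨc, hΨl, hev0, hev1] at h0 h1
        have hb : b = 0 := by
          have : b * (P : ℤ) = 0 := by linarith
          rcases mul_eq_zero.1 this with h | h
          exacts [h, absurd h hP0]
        subst hb
        exact ⟨by linarith, rfl⟩
      · have h0 := hab (fun _ => 0)
        have h1 := hab (fun _ => 1)
        simp only [hΨc, hΨl, hev0, hev1] at h0 h1
        have ha : a = 0 := by
          have : a * (P : ℤ) = 0 := by linarith
          rcases mul_eq_zero.1 this with h | h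
          exacts [h, absurd h hP0]
        subst ha
        exact ⟨rfl, by linarith⟩
      · exact absurd rfl hij
  -- (6) the scale `N`
  have hev : ∀ᶠ N : ℕ in atTop, Real.log ((N : ℝ) + 1) ≤ (N : ℝ) / 10 ∧
      2 * Real.sqrt (N : ℝ) * Real.log (N : ℝ) ≤ (N : ℝ) / 5 := by
    have h1 : ∀ᶠ x : ℝ in atTop, Real.log (x + 1) ≤ x / 10 := by
      have hlo := Real.isLittleO_log_id_atTop.comp_tendsto
        (tendsto_atTop_mono (fun x : ℝ => show x ≤ x + 1 by linarith) tendsto_id)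
      filter_upwards [hlo.bound (show (0 : ℝ) < 1 / 20 by norm_num), eventually_ge_atTop (1 : ℝ)]
        with x hx hx1
      simp only [Function.comp_apply, id_eq, Real.norm_eq_abs] at hx
      rw [abs_of_nonneg (Real.log_nonneg (by linarith)), abs_of_nonneg (by linarith)] at hx
      linarith
    have h2 : ∀ᶠ x : ℝ in atTop, 2 * Real.sqrt x * Real.log x ≤ x / 5 := by
      filter_upwards [(isLittleO_log_rpow_atTop (show (0 : ℝ) < 1 / 2 by norm_num)).bound
          (show (0 : ℝ) < 1 / 10 by norm_num), eventually_ge_atTop (1 : ℝ)] with x hx hx1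
      rw [Real.norm_eq_abs, Real.norm_eq_abs, abs_of_nonneg (Real.log_nonneg hx1),
        abs_of_nonneg (by positivity), ← Real.sqrt_eq_rpow] at hx
      have hs : Real.sqrt x * Real.sqrt x = x := Real.mul_self_sqrt (by linarith)
      calc 2 * Real.sqrt x * Real.log x ≤ 2 * Real.sqrt x * (1 / 10 * Real.sqrt x) := by
            gcongr
        _ = x / 5 := by rw [show 2 * Real.sqrt x * (1 / 10 * Real.sqrt x)
              = Real.sqrt x * Real.sqrt x / 5 by ring, hs]
    exact (h1.and h2).natCast_atTop
  obtain ⟨N, hN₀, hPN, hzN, hlog1, hlog2⟩ := ((eventually_ge_atTop N₀).and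
    ((eventually_ge_atTop P).and ((eventually_ge_atTop (14 * z)).and hev))).exists
  have hzN' : z ≤ N := hzP.trans hPN
  have hNpos : 0 < N := by omega
  have hsz : affLinSize Ψ (N : ℝ) ≤ (3 : ℕ) := by
    have hN' : (0 : ℝ) < N := by exact_mod_cast hNpos
    have habs : |(P : ℝ) / (N : ℝ)| = (P : ℝ) / N := abs_of_nonneg (by positivity)
    have h1 : (P : ℝ) / (N : ℝ) ≤ 1 := by
      rw [div_le_one hN']
      exact_mod_cast hPN
    have h2 : affLinSize Ψ (N : ℝ) = 2 + (P : ℝ) / N := by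
      simp only [affLinSize, Fin.sum_univ_castSucc, Fin.sum_univ_zero, hΨl, hΨc, Int.cast_one,
        Int.cast_zero, Int.cast_natCast, abs_one, zero_div, abs_zero, zero_add, habs]
      ring
    rw [h2]
    push_cast
    linarith
  -- (7) the claimed bound on the witness
  have key := hP N hN₀ Ψ hnd hsz 1 N (by omega) le_rfl f hfmul hfle
    (fun q χ τ _ _ _ => hdist _ (htw χ τ) N (by exact_mod_cast hzN'))
  simp only [hΨl, hΨc, hev0, hev1, Fin.prod_univ_one] at key
  rw [Finset.filter_true_of_mem (fun n hn => by rw [Finset.mem_Icc] at hn; omega)] at key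
  -- (8) evaluate both sides
  have hreindex : ∀ {M : Type} [AddCommMonoid M] (g : ℤ → M),
      ∑ n ∈ Finset.Icc (1 : ℤ) (N : ℤ), g n = ∑ m ∈ Finset.Icc 1 N, g (m : ℤ) := by
    intro M _ g
    refine Finset.sum_nbij' (fun n => n.toNat) (fun m => (m : ℤ)) ?_ ?_ ?_ ?_ ?_
    · intro n hn; rw [Finset.mem_Icc] at hn ⊢; omega
    · intro m hm; rw [Finset.mem_Icc] at hm ⊢; omega
    · intro n hn; rw [Finset.mem_Icc] at hn; omega
    · intro m _; simp
    · intro n hn; rw [Finset.mem_Icc] at hn; congr 1; omega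
  obtain ⟨R, hR⟩ : ∃ R : ℝ, R = ∑ m ∈ Finset.Icc 1 N, if Nat.Coprime m P then Λ m else 0 :=
    ⟨_, rfl⟩
  have hR0 : 0 ≤ R := hR ▸ Finset.sum_nonneg fun m _ => by
    split_ifs
    exacts [ArithmeticFunction.vonMangoldt_nonneg, le_rfl]
  have hlhs : ‖∑ n ∈ Finset.Icc (1 : ℤ) (N : ℤ),
      ((intVonMangoldt n : ℝ) : ℂ) * f (n + (P : ℤ)).toNat‖ = R := by
    have : ∑ n ∈ Finset.Icc (1 : ℤ) (N : ℤ), ((intVonMangoldt n : ℝ) : ℂ) * f (n + (P : ℤ)).toNat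
        = ((R : ℝ) : ℂ) := by
      rw [hreindex, hR, Complex.ofReal_sum]
      refine Finset.sum_congr rfl fun m hm => ?_
      have h1 : ((m : ℤ) + (P : ℤ)).toNat = m + P := by rw [← Nat.cast_add, Int.toNat_natCast]
      rw [h1, hf]
      by_cases hc : Nat.Coprime m P
      · rw [if_pos (Nat.coprime_add_self_left.2 hc), if_pos hc]
        simp [intVonMangoldt]
      · rw [if_neg (fun h' => hc (Nat.coprime_add_self_left.1 h')), if_neg hc]
        simp
    rw [this, Complex.norm_real, Real.norm_of_nonneg hR0]
  have hrhs : ∑ n ∈ Finset.Icc (1 : ℤ) (N : ℤ), intVonMangoldt n = Chebyshev.psi N := by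
    rw [hreindex, Chebyshev.psi, Nat.floor_natCast]
    have : Finset.Ioc 0 N = Finset.Icc 1 N := by
      ext m
      simp only [Finset.mem_Ioc, Finset.mem_Icc]
      omega
    rw [this]
    refine Finset.sum_congr rfl fun m _ => ?_
    simp [intVonMangoldt]
  rw [hlhs, hrhs] at key
  -- (9) `θ(N) - θ(z) ≤ R`: primes in `(z, N]` are coprime to `P`
  have hθ : Chebyshev.theta N - Chebyshev.theta z ≤ R := by
    rw [Chebyshev.theta_eq_sum_primesLE_log, Chebyshev.theta_eq_sum_primesLE_log, hR]
    have hsub : Nat.primesLE z ⊆ Nat.primesLE N := fun p hp => by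
      rw [Nat.mem_primesLE] at hp ⊢
      exact ⟨hp.1.trans hzN', hp.2⟩
    rw [← Finset.sum_sdiff_eq_sub hsub]
    calc ∑ p ∈ Nat.primesLE N \ Nat.primesLE z, Real.log p
        = ∑ p ∈ Nat.primesLE N \ Nat.primesLE z, (if Nat.Coprime p P then Λ p else 0) := by
          refine Finset.sum_congr rfl fun p hp => ?_
          rw [Finset.mem_sdiff, Nat.mem_primesLE, Nat.mem_primesLE] at hp
          obtain ⟨⟨_, hp⟩, hnot⟩ := hp
          have hzp : ¬ p ≤ z := fun h' => hnot ⟨h', hp⟩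
          rw [if_pos (hp.coprime_iff_not_dvd.2 (fun hd => hzp ((hpP p hp).1 hd))),
            ArithmeticFunction.vonMangoldt_apply_prime hp]
      _ ≤ _ := by
          refine Finset.sum_le_sum_of_subset_of_nonneg (fun p hp => ?_) fun m _ _ => ?_
          · rw [Finset.mem_sdiff, Nat.mem_primesLE] at hp
            rw [Finset.mem_Icc]
            exact ⟨hp.1.2.one_lt.le, hp.1.1⟩
          · split_ifs
            exacts [ArithmeticFunction.vonMangoldt_nonneg, le_rfl]
  -- (10) Chebyshev: `R ≥ 0.29 N` but `key : R ≤ (N + ψ N) / 1000 ≤ 0.0064 N`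
  have h2 := Chebyshev.theta_ge N
  have h3 := Chebyshev.theta_le_log4_mul_x (Nat.cast_nonneg z)
  have h4 := Chebyshev.psi_le_const_mul_self (Nat.cast_nonneg N)
  have hlog4 : Real.log 4 = 2 * Real.log 2 := by
    rw [show (4 : ℝ) = 2 ^ 2 by norm_num, Real.log_pow]
    push_cast
    ring
  rw [hlog4] at h3 h4
  have hl2 := Real.log_two_lt_d9
  have hl2' := Real.log_two_gt_d9
  have hzr : (14 * z : ℝ) ≤ N := by exact_mod_cast hzN
  have hN1 : (1 : ℝ) ≤ N := by exact_mod_cast hNpos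
  have hz0 : (0 : ℝ) ≤ z := Nat.cast_nonneg z
  have e1 : 0.6931471803 * (N : ℝ) ≤ Real.log 2 * N := mul_le_mul_of_nonneg_right hl2'.le (by positivity)
  have e2 : Real.log 2 * (z : ℝ) ≤ 0.6931471808 * z := mul_le_mul_of_nonneg_right hl2.le hz0
  have e3 : Real.log 2 * (N : ℝ) ≤ 0.6931471808 * N := mul_le_mul_of_nonneg_right hl2.le (by positivity)
  linarith

end Summit.Parity.GeneralizedHardyLittlewood.Theorems
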